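import Summits.ABC.IUTFork.LDHGenuinePerImageBroberg
import Literature.NumberTheory.QuadraticFields.RealQuadraticRegulator
import HarnessLib

/-!
# The fork at [IUTchIII] Corollary 3.12, L-DH level, READING (P): the Broberg point at EVERY prime level `l ≥ 5` — the four small
# levels `5, 7, 11, 13` via the EXACT log-different `½·log 28` of `ℚ(√7)` (abc-iut cell, branch C, row «C:PERIMAGE-BROBERG», part 2;
# seat abc-iut-C-cert-2 gen 6)

Record-only PROOF file (D-0012; 0 definitions, 0 `Prop` facts) of the abc-iut cell. TAKES NO SIDE on [IUTchIII] Cor. 3.12 or on any author.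
Part 1 (`LDHGenuinePerImageBroberg`, p504748) proved the reading-(P) per-image Corollary at the quadratic Broberg point for every prime
`l ≥ 17` using only the Hermite–Minkowski bound `log-diff ≥ ½·log 3`, and left `l ∈ {5, 7, 11, 13}` as an honest residual «pending
`disc ℚ(√7) = 28`». That number is NOT a new fact: the tree's Literature already proves the discriminant of a quadratic field containing
`√d`, `d ≥ 2` squarefree (`Literature.NumberTheory.QuadraticFields.Quadratic.discr_eq_fundDiscr`, `RealQuadraticRegulator.lean` — Marcus Ch. 2
Thm. 1 via fundamental discriminants), so with abc-iut-W-row-2's `Sqrt7.sqrt7_sq` / `Sqrt7.finrank_eq_two`: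

* **`Broberg.discr_eq`** — `disc ℚ(√7) = 28` (`fundDiscr 7 = 4·7`); **`Broberg.logDiff_eq`** — `log-diff(λ_Broberg) = ½·log 28`;
* `cor312PerImageOf_of_scalar_discr` — part 1's scalar reduction with the exact log-different;
* **`cor312PerImageOf_five / _seven / _eleven / _thirteen`** — the four residual levels (certificates of ≤ 8 digits, `π > 3`; margins
  0.54 / 0.43 / 1.65 / 2.59 nats);
* **`Broberg.cor312PerImageOf_every`** — for EVERY prime `l ≥ 5` and EVERY genuine Θ-volume datum `T` of `(λ_Broberg, l)`, `T.Cor312PerImageOf`,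
  NO hypothesis (`l ≥ 17` from part 1) — the full `l`-range of the books' binders at the quadratic point.

READING (neutral; branch-C books): at the Broberg point the reading-(P) number binders' conclusion is TRUE at every admissible level; the reading-(U)
twin at `l = 7, 11` is abc-iut-C-cert-3's p503174. No record count moves; (Ind2) = the cell's typing; nothing about print's (Ind2) or the printed
inequality; nothing asserts that genuine data exist at any `(λ, l)`; proved-as-typed ≠ in print; typed ≠ proved. Ruling C-R100 (b) asked for no
FACT/GAP row on the discriminant — none is introduced: the discriminant is derived from landed Literature theorems.
[cite: Mochizuki2012, IUTchIII Cor. 3.12 p. 173–174, proof Step (x) p. 181; IUTchIV Thm. 1.10 p. 22–24, Step (v) p. 27–29] [cite: MochizukiGenEll2010,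
Def. 1.5 (iii) p. 8] [cite: Jozsa2003, §3 Thm 2] [cite: NeukirchANT1999, Ch. I §8] [claim: Mochizuki2012, status: disputed] for every IUT quotation.
-/

noncomputable section

open scoped Classical NumberField

open NumberField IsDedekindDomain IsDedekindDomain.HeightOneSpectrum

namespace Summit.ABC.IUTFork.Broberg

open Sqrt7 Literature.IUT.LogVolume Literature.IUT.LogVolume.Cor22 Literature.NumberTheory.NumberFields
  Literature.NumberTheory.DiophantineGeometry.GenEll Literature.NumberTheory.QuadraticFields.Quadratic

/-! ## §1. The discriminant and the exact log-different -/

/-- **`disc ℚ(√7) = 28`** — the tree's `Quadratic.discr_eq_fundDiscr` (`d = 7` squarefree, `√7 ∈ K`) and `fundDiscr 7 = 4·7`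
(`7 ≢ 1 mod 4`). [cite: Jozsa2003, §3 Thm 2] -/
theorem discr_eq : NumberField.discr K = 28 := by
  have hsq : (sqrt7 : K) ^ 2 = ((7 : ℕ) : K) := by rw [sqrt7_sq]; norm_num
  rw [discr_eq_fundDiscr finrank_eq_two (Nat.prime_iff.1 (by norm_num)).squarefree (by norm_num) hsq,
    fundDiscr_of_mod_four_ne_one (by norm_num)]
  norm_num

/-- **`log-diff(λ_Broberg) = ½·log 28`** (`logDiff_eq_log_discr`, `[ℚ(√7):ℚ] = 2`). [cite: MochizukiGenEll2010, Def. 1.5 (iii) p. 8] -/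
theorem logDiff_eq : point.logDiff = Real.log 28 / 2 := by
  rw [NFPoint.logDiff_eq_log_discr, point_degree]
  have h : (NumberField.discr point.F).natAbs = 28 := by
    rw [show NumberField.discr point.F = 28 from discr_eq]; rfl
  rw [h]
  push_cast
  ring

/-! ## §2. The scalar reduction with the exact log-different, and the four small levels -/

/-- Part 1's scalar reduction with `log-diff = ½·log 28` in place of the Hermite bound: if
`κ_l·Q ≤ ((l+5)/4 − 2)·(½·log 28 + (1 − 1/l)·C + (1 − 2/(l−1))·½·log l) + ((l+5)/4)·log π` then `T.Cor312PerImageOf` at every genuine datum.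
[cite: Mochizuki2012, IUTchIII Cor. 3.12 p. 173–174; IUTchIV Thm. 1.10 Step (v) p. 27–29] [claim: Mochizuki2012, status: disputed] -/
theorem cor312PerImageOf_of_scalar_discr {l : ℕ} (hl : l.Prime) (h5 : 5 ≤ l)
    (h : (((l : ℝ) + 1) / 24 - 1 / (2 * l)) * logQAvoid point {2, l} ≤
      (((l : ℝ) + 5) / 4 - 2) * (Real.log 28 / 2 + (1 - 1 / (l : ℝ)) * logCondAvoid point {2, l}
          + (1 - 2 / ((l : ℝ) - 1)) * (2⁻¹ * Real.log l))
        + ((l : ℝ) + 5) / 4 * Real.log Real.pi) :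
    ∀ T : ThetaVolumeDatumAt point l, T.Cor312PerImageOf := by
  have hl5 : (5 : ℝ) ≤ l := by exact_mod_cast h5
  have hd : (dmod point : ℝ) ≤ ((l : ℝ) + 5) / 4 := le_trans dmod_le_two (by linarith)
  refine cor312PerImageOf_of_le_degree_all point_inU hl h5 hd ?_
  rw [point_degree]
  push_cast
  have hC0 : 0 ≤ logCondAvoid point {2, l} := logCondAvoid_nonneg point _
  have hlog0 : 0 ≤ Real.log l := Real.log_nonneg (by linarith)
  have h1l : 0 ≤ 1 - 1 / (l : ℝ) := by
    have : 1 / (l : ℝ) ≤ 1 / 5 := one_div_le_one_div_of_le (by norm_num) hl5; linarith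
  have h2l : 0 ≤ 1 - 2 / ((l : ℝ) - 1) := by
    rw [sub_nonneg, div_le_one (by linarith)]; linarith
  have hB0 : 0 ≤ Real.log 28 / 2 + (1 - 1 / (l : ℝ)) * logCondAvoid point {2, l} + (1 - 2 / ((l : ℝ) - 1)) * (2⁻¹ * Real.log l) := by
    have : 0 ≤ Real.log 28 := Real.log_nonneg (by norm_num)
    positivity
  have hLD := logDiff_eq
  have step1 : (((l : ℝ) + 5) / 4 - 2) *
      (Real.log 28 / 2 + (1 - 1 / (l : ℝ)) * logCondAvoid point {2, l} + (1 - 2 / ((l : ℝ) - 1)) * (2⁻¹ * Real.log l)) ≤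
      (((l : ℝ) + 5) / 4 - (dmod point : ℝ)) *
      (point.logDiff + (1 - 1 / (l : ℝ)) * logCondAvoid point {2, l} + (1 - 2 / ((l : ℝ) - 1)) * (2⁻¹ * Real.log l)) :=
    mul_le_mul (by linarith [dmod_le_two]) (by linarith) hB0 (by linarith [dmod_le_two])
  linarith

/-- **Level `l = 5`** at the Broberg point: `T.Cor312PerImageOf` at every genuine `T` — NO hypothesis (exact log-different `½·log 28`;
certificate `47^4 ≤ 2^4·3^7·5·7^2`, `π > 3`). [cite: Mochizuki2012, IUTchIII Cor. 3.12 p. 173–174] [claim: Mochizuki2012, status: disputed] -/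
theorem cor312PerImageOf_five (T : ThetaVolumeDatumAt point 5) : T.Cor312PerImageOf := by
  refine cor312PerImageOf_of_scalar_discr (by norm_num) (by norm_num) ?_ T
  rw [logQAvoid_pair_of_ne (by norm_num) (by norm_num) (by norm_num), logCondAvoid_pair_of_ne (by norm_num) (by norm_num) (by norm_num)]
  have hp2 : 0 < Real.log 2 := Real.log_pos (by norm_num)
  have hp3 : 0 < Real.log 3 := Real.log_pos (by norm_num)
  have hp5 : 0 < Real.log 5 := Real.log_pos (by norm_num)
  have hp7 : 0 < Real.log 7 := Real.log_pos (by norm_num)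
  have hp47 : 0 < Real.log 47 := Real.log_pos (by norm_num)
  have hpi : Real.log 3 < Real.log Real.pi := Real.log_lt_log (by norm_num) Real.pi_gt_three
  have h28 : Real.log 28 = 2 * Real.log 2 + Real.log 7 := by
    rw [show (28 : ℝ) = 2 ^ 2 * 7 by norm_num, Real.log_mul (by positivity) (by positivity), Real.log_pow]; push_cast; ring
  have hZ : (47 ^ 4 : ℕ) ≤ 2 ^ 4 * 3 ^ 7 * 5 * 7 ^ 2 := by norm_num
  have hR : ((47 : ℝ) ^ 4) ≤ (2 : ℝ) ^ 4 * (3 : ℝ) ^ 7 * (5 : ℝ) * (7 : ℝ) ^ 2 := by exact_mod_cast hZ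
  have hlog := Real.log_le_log (by positivity) hR
  repeat rw [Real.log_mul (by positivity) (by positivity)] at hlog
  simp only [Real.log_pow] at hlog; push_cast at hlog ⊢
  rw [h28]
  norm_num
  linarith [hlog, hpi, hp2, hp3, hp5, hp7, hp47]

/-- **Level `l = 7`** at the Broberg point: `T.Cor312PerImageOf` at every genuine `T` — NO hypothesis (exact log-different `½·log 28`;
certificate `47^4 ≤ 2^6·3^2·7^5`, `π > 3`). [cite: Mochizuki2012, IUTchIII Cor. 3.12 p. 173–174] [claim: Mochizuki2012, status: disputed] -/
theorem cor312PerImageOf_seven (T : ThetaVolumeDatumAt point 7) : T.Cor312PerImageOf := by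
  refine cor312PerImageOf_of_scalar_discr (by norm_num) (by norm_num) ?_ T
  rw [logQAvoid_pair_of_ne (by norm_num) (by norm_num) (by norm_num), logCondAvoid_pair_of_ne (by norm_num) (by norm_num) (by norm_num)]
  have hp2 : 0 < Real.log 2 := Real.log_pos (by norm_num)
  have hp3 : 0 < Real.log 3 := Real.log_pos (by norm_num)
  have hp7 : 0 < Real.log 7 := Real.log_pos (by norm_num)
  have hp47 : 0 < Real.log 47 := Real.log_pos (by norm_num)
  have hpi : Real.log 3 < Real.log Real.pi := Real.log_lt_log (by norm_num) Real.pi_gt_three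
  have h28 : Real.log 28 = 2 * Real.log 2 + Real.log 7 := by
    rw [show (28 : ℝ) = 2 ^ 2 * 7 by norm_num, Real.log_mul (by positivity) (by positivity), Real.log_pow]; push_cast; ring
  have hZ : (47 ^ 4 : ℕ) ≤ 2 ^ 6 * 3 ^ 2 * 7 ^ 5 := by norm_num
  have hR : ((47 : ℝ) ^ 4) ≤ (2 : ℝ) ^ 6 * (3 : ℝ) ^ 2 * (7 : ℝ) ^ 5 := by exact_mod_cast hZ
  have hlog := Real.log_le_log (by positivity) hR
  repeat rw [Real.log_mul (by positivity) (by positivity)] at hlog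
  simp only [Real.log_pow] at hlog; push_cast at hlog ⊢
  rw [h28]
  norm_num
  linarith [hlog, hpi, hp2, hp3, hp7, hp47]

/-- **Level `l = 11`** at the Broberg point: `T.Cor312PerImageOf` at every genuine `T` — NO hypothesis (exact log-different `½·log 28`;
certificate `3·47^2 ≤ 2^4·7^2·11`, `π > 3`). [cite: Mochizuki2012, IUTchIII Cor. 3.12 p. 173–174] [claim: Mochizuki2012, status: disputed] -/
theorem cor312PerImageOf_eleven (T : ThetaVolumeDatumAt point 11) : T.Cor312PerImageOf := by
  refine cor312PerImageOf_of_scalar_discr (by norm_num) (by norm_num) ?_ T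
  rw [logQAvoid_pair_of_ne (by norm_num) (by norm_num) (by norm_num), logCondAvoid_pair_of_ne (by norm_num) (by norm_num) (by norm_num)]
  have hp2 : 0 < Real.log 2 := Real.log_pos (by norm_num)
  have hp3 : 0 < Real.log 3 := Real.log_pos (by norm_num)
  have hp7 : 0 < Real.log 7 := Real.log_pos (by norm_num)
  have hp11 : 0 < Real.log 11 := Real.log_pos (by norm_num)
  have hp47 : 0 < Real.log 47 := Real.log_pos (by norm_num)
  have hpi : Real.log 3 < Real.log Real.pi := Real.log_lt_log (by norm_num) Real.pi_gt_three
  have h28 : Real.log 28 = 2 * Real.log 2 + Real.log 7 := by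
    rw [show (28 : ℝ) = 2 ^ 2 * 7 by norm_num, Real.log_mul (by positivity) (by positivity), Real.log_pow]; push_cast; ring
  have hZ : (3 * 47 ^ 2 : ℕ) ≤ 2 ^ 4 * 7 ^ 2 * 11 := by norm_num
  have hR : ((3 : ℝ) * (47 : ℝ) ^ 2) ≤ (2 : ℝ) ^ 4 * (7 : ℝ) ^ 2 * (11 : ℝ) := by exact_mod_cast hZ
  have hlog := Real.log_le_log (by positivity) hR
  repeat rw [Real.log_mul (by positivity) (by positivity)] at hlog
  simp only [Real.log_pow] at hlog; push_cast at hlog ⊢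
  rw [h28]
  norm_num
  linarith [hlog, hpi, hp2, hp3, hp7, hp11, hp47]

/-- **Level `l = 13`** at the Broberg point: `T.Cor312PerImageOf` at every genuine `T` — NO hypothesis (exact log-different `½·log 28`;
certificate `3·47^4 ≤ 2^7·7^3·13^3`, `π > 3`). [cite: Mochizuki2012, IUTchIII Cor. 3.12 p. 173–174] [claim: Mochizuki2012, status: disputed] -/
theorem cor312PerImageOf_thirteen (T : ThetaVolumeDatumAt point 13) : T.Cor312PerImageOf := by
  refine cor312PerImageOf_of_scalar_discr (by norm_num) (by norm_num) ?_ T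
  rw [logQAvoid_pair_of_ne (by norm_num) (by norm_num) (by norm_num), logCondAvoid_pair_of_ne (by norm_num) (by norm_num) (by norm_num)]
  have hp2 : 0 < Real.log 2 := Real.log_pos (by norm_num)
  have hp3 : 0 < Real.log 3 := Real.log_pos (by norm_num)
  have hp7 : 0 < Real.log 7 := Real.log_pos (by norm_num)
  have hp13 : 0 < Real.log 13 := Real.log_pos (by norm_num)
  have hp47 : 0 < Real.log 47 := Real.log_pos (by norm_num)
  have hpi : Real.log 3 < Real.log Real.pi := Real.log_lt_log (by norm_num) Real.pi_gt_three
  have h28 : Real.log 28 = 2 * Real.log 2 + Real.log 7 := by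
    rw [show (28 : ℝ) = 2 ^ 2 * 7 by norm_num, Real.log_mul (by positivity) (by positivity), Real.log_pow]; push_cast; ring
  have hZ : (3 * 47 ^ 4 : ℕ) ≤ 2 ^ 7 * 7 ^ 3 * 13 ^ 3 := by norm_num
  have hR : ((3 : ℝ) * (47 : ℝ) ^ 4) ≤ (2 : ℝ) ^ 7 * (7 : ℝ) ^ 3 * (13 : ℝ) ^ 3 := by exact_mod_cast hZ
  have hlog := Real.log_le_log (by positivity) hR
  repeat rw [Real.log_mul (by positivity) (by positivity)] at hlog
  simp only [Real.log_pow] at hlog; push_cast at hlog ⊢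
  rw [h28]
  norm_num
  linarith [hlog, hpi, hp2, hp3, hp7, hp13, hp47]

/-! ## §3. Every prime level -/

/-- **READING (P) AT THE QUADRATIC BROBERG POINT, EVERY PRIME LEVEL `l ≥ 5`** — `T.Cor312PerImageOf` for EVERY genuine Θ-volume datum
`T` of `(λ_Broberg, l)`, NO hypothesis: `l ∈ {5,7,11,13}` here, `l ≥ 17` = part 1's `cor312PerImageOf_of_seventeen_le`.
[cite: Mochizuki2012, IUTchIII Cor. 3.12 p. 173–174; IUTchIV Thm. 1.10 Step (v) p. 27–29] [claim: Mochizuki2012, status: disputed] -/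
theorem cor312PerImageOf_every {l : ℕ} (hl : l.Prime) (h5 : 5 ≤ l) (T : ThetaVolumeDatumAt point l) : T.Cor312PerImageOf := by
  by_cases h17 : 17 ≤ l
  · exact cor312PerImageOf_of_seventeen_le hl h17 T
  · interval_cases l
    · exact cor312PerImageOf_five T
    · exact absurd hl (by norm_num)
    · exact cor312PerImageOf_seven T
    · exact absurd hl (by norm_num)
    · exact absurd hl (by norm_num)
    · exact absurd hl (by norm_num)
    · exact cor312PerImageOf_eleven T
    · exact absurd hl (by norm_num)
    · exact cor312PerImageOf_thirteen T
    · exact absurd hl (by norm_num)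
    · exact absurd hl (by norm_num)
    · exact absurd hl (by norm_num)

end Summit.ABC.IUTFork.Broberg

end
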